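import Mathlib
import Summits.CriticalPhenomena.Ising3DConformalLimit.Theorems.PrecisionLaplacianEtaBoundsTransferTrig
import Summits.CriticalPhenomena.Ising3DConformalLimit.Theorems.PrecisionLaplacianEtaBoundsTransferOrtho
import HarnessLib

/-!
# The Brillouin-zone integral `∫ ‖k‖^{-α} ∏ D_m(k_j)² ≲ (2m+1)^{d+α}`

Helper file for item `stmt-CriticalPhenomena-4804`
(`Summit.CriticalPhenomena.Ising3DConformalLimit.Theses.PrecisionLaplacian.EtaBoundsTransfer`), part of its
unconditional proof: potential theory of inverse M-matrices ⇒ infinite-volume equation and Green-function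
representation; Fourier analysis on `[-π,π]^d` ⇒ block-sum upper bounds; quadratic test function ⇒ ball-sum
lower bounds; Messager–Miracle-Solé ⇒ pointwise two-sided power bounds. No definitions are introduced: the
objects (kernel matrices, box sequences, convolution powers) enter through defining hypotheses.
-/

namespace Summit.CriticalPhenomena.Ising3DConformalLimit.Theorems.EtaBoundsTransfer

open Real MeasureTheory Set intervalIntegral
open scoped BigOperators

section Integral1D

/-- The one-dimensional majorant `g(t) = |t|^{-s} · min(M, π/|t|)²` is measurable. -/
theorem measurable_majorant (s M : ℝ) :
    Measurable fun t : ℝ => |t| ^ (-s) * (min M (π / |t|)) ^ 2 := by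
  refine Measurable.mul ?_ ?_
  · exact (measurable_id.abs).pow_const _
  · exact (measurable_const.min (measurable_const.div measurable_id.abs)).pow_const _

/-- `t ↦ |t|^{-s}` is interval integrable for `s < 1`. -/
theorem intervalIntegrable_abs_rpow_neg {s : ℝ} (hs : s < 1) (a b : ℝ) :
    IntervalIntegrable (fun t : ℝ => |t| ^ (-s)) volume a b := by
  have key : ∀ c : ℝ, 0 ≤ c → IntervalIntegrable (fun t : ℝ => |t| ^ (-s)) volume 0 c := by
    intro c hc
    have h1 : IntervalIntegrable (fun t : ℝ => t ^ (-s)) volume 0 c :=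
      intervalIntegral.intervalIntegrable_rpow' (by linarith)
    rw [intervalIntegrable_iff] at h1 ⊢
    refine h1.congr_fun (fun t ht => ?_) measurableSet_uIoc
    rw [Set.uIoc_of_le hc] at ht
    simp only [abs_of_pos ht.1]
  have h : ∀ c : ℝ, IntervalIntegrable (fun t : ℝ => |t| ^ (-s)) volume 0 c := by
    intro c
    rcases le_total 0 c with hc | hc
    · exact key c hc
    · rw [IntervalIntegrable.iff_comp_neg, neg_zero]
      simp only [abs_neg]
      exact key (-c) (by linarith)
  exact (h a).symm.trans (h b)

/-- The majorant is dominated by `M² |t|^{-s}` (for `M ≥ 0`). -/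
theorem majorant_le_sq_mul {s M : ℝ} (hM : 0 ≤ M) (t : ℝ) :
    |t| ^ (-s) * (min M (π / |t|)) ^ 2 ≤ M ^ 2 * |t| ^ (-s) := by
  rw [mul_comm]
  refine mul_le_mul_of_nonneg_right ?_ (Real.rpow_nonneg (abs_nonneg t) _)
  have hmin : min M (π / |t|) ≤ M := min_le_left _ _
  have hmin0 : 0 ≤ min M (π / |t|) := le_min hM (div_nonneg Real.pi_pos.le (abs_nonneg t))
  exact pow_le_pow_left₀ hmin0 hmin 2

/-- The majorant is nonnegative. -/
theorem majorant_nonneg (s M : ℝ) (t : ℝ) :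
    0 ≤ |t| ^ (-s) * (min M (π / |t|)) ^ 2 :=
  mul_nonneg (Real.rpow_nonneg (abs_nonneg t) _) (sq_nonneg _)

/-- The majorant is interval integrable (for `s < 1`, `M ≥ 0`). -/
theorem intervalIntegrable_majorant {s M : ℝ} (hs : s < 1) (hM : 0 ≤ M) (a b : ℝ) :
    IntervalIntegrable (fun t : ℝ => |t| ^ (-s) * (min M (π / |t|)) ^ 2) volume a b := by
  refine IntervalIntegrable.mono_fun' ((intervalIntegrable_abs_rpow_neg hs a b).const_mul (M ^ 2))
    (measurable_majorant s M).aestronglyMeasurable ?_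
  refine Filter.Eventually.of_forall fun t => ?_
  dsimp only
  rw [Real.norm_eq_abs, abs_of_nonneg (majorant_nonneg s M t)]
  exact majorant_le_sq_mul hM t

/-- **The half-line estimate**: for `0 < s < 1` and `M ≥ 1`,
`∫_0^π |t|^{-s} min(M, π/|t|)² dt ≤ π^{1-s} (1/(1-s) + 1/(1+s)) M^{1+s}`
(split at `π/M`: `M² t^{-s}` below, `π² t^{-2-s}` above). -/
theorem integral_majorant_half_le {s M : ℝ} (hs0 : 0 < s) (hs : s < 1) (hM : 1 ≤ M) :
    ∫ t in (0:ℝ)..π, |t| ^ (-s) * (min M (π / |t|)) ^ 2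
      ≤ π ^ (1 - s) * (1 / (1 - s) + 1 / (1 + s)) * M ^ (1 + s) := by
  have hπ := Real.pi_pos
  have hM0 : 0 < M := by linarith
  have hc : 0 < π / M := by positivity
  have hcπ : π / M ≤ π := div_le_self hπ.le hM
  set g : ℝ → ℝ := fun t => |t| ^ (-s) * (min M (π / |t|)) ^ 2 with hg
  have hgi : ∀ a b, IntervalIntegrable g volume a b := fun a b => intervalIntegrable_majorant hs hM0.le a b
  rw [← integral_add_adjacent_intervals (hgi 0 (π / M)) (hgi (π / M) π)]
  -- first piece
  have h1 : ∫ t in (0:ℝ)..π / M, g t ≤ ∫ t in (0:ℝ)..π / M, M ^ 2 * t ^ (-s) := by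
    refine intervalIntegral.integral_mono_on hc.le (hgi _ _)
      ((intervalIntegral.intervalIntegrable_rpow' (by linarith)).const_mul _) fun t ht => ?_
    have := majorant_le_sq_mul (s := s) hM0.le t
    rw [abs_of_nonneg ht.1] at this
    simpa only [hg, abs_of_nonneg ht.1] using this
  have h1v : ∫ t in (0:ℝ)..π / M, M ^ 2 * t ^ (-s) = π ^ (1 - s) / (1 - s) * M ^ (1 + s) := by
    rw [intervalIntegral.integral_const_mul, integral_rpow (Or.inl (by linarith))]
    rw [Real.zero_rpow (by linarith), sub_zero, show -s + 1 = 1 - s by ring,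
      Real.div_rpow hπ.le hM0.le]
    have hM1 : M ^ 2 = M ^ (1 + s) * M ^ (1 - s) := by
      rw [← Real.rpow_add hM0, show 1 + s + (1 - s) = ((2 : ℕ) : ℝ) by push_cast; ring, Real.rpow_natCast]
    rw [hM1]
    have hMs : 0 < M ^ (1 - s) := Real.rpow_pos_of_pos hM0 _
    have h1s : (0:ℝ) < 1 - s := by linarith
    field_simp
  -- second piece
  have h2 : ∫ t in π / M..π, g t ≤ ∫ t in π / M..π, π ^ 2 * t ^ (-2 - s) := by
    refine intervalIntegral.integral_mono_on hcπ (hgi _ _) ?_ fun t ht => ?_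
    · refine (intervalIntegral.intervalIntegrable_rpow (Or.inr ?_)).const_mul _
      rw [uIcc_of_le hcπ]
      exact fun h => (lt_irrefl (0:ℝ)) (lt_of_lt_of_le hc h.1)
    · have ht0 : 0 < t := lt_of_lt_of_le hc ht.1
      simp only [hg, abs_of_pos ht0]
      have hmin : min M (π / t) ≤ π / t := min_le_right _ _
      have hmin0 : 0 ≤ min M (π / t) := le_min hM0.le (by positivity)
      calc t ^ (-s) * (min M (π / t)) ^ 2 ≤ t ^ (-s) * (π / t) ^ 2 :=
            mul_le_mul_of_nonneg_left (pow_le_pow_left₀ hmin0 hmin 2) (Real.rpow_nonneg ht0.le _)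
        _ = π ^ 2 * t ^ (-2 - s) := by
            rw [div_pow, show -2 - s = -s - (2 : ℝ) by ring, Real.rpow_sub ht0, Real.rpow_two]
            field_simp
  have h2v : ∫ t in π / M..π, π ^ 2 * t ^ (-2 - s) ≤ π ^ (1 - s) / (1 + s) * M ^ (1 + s) := by
    have hne : ∀ h : (0:ℝ) ∈ Set.uIcc (π / M) π, False := by
      rw [uIcc_of_le hcπ]
      exact fun h => (lt_irrefl (0:ℝ)) (lt_of_lt_of_le hc h.1)
    rw [intervalIntegral.integral_const_mul, integral_rpow (Or.inr ⟨by linarith, fun h => hne h⟩)]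
    rw [show -2 - s + 1 = -(1 + s) by ring, Real.div_rpow hπ.le hM0.le, Real.rpow_neg hπ.le,
      Real.rpow_neg hM0.le]
    have hps : (0:ℝ) < 1 + s := by linarith
    have hA : 0 < π ^ (1 + s) := Real.rpow_pos_of_pos hπ _
    have hB : 0 < M ^ (1 + s) := Real.rpow_pos_of_pos hM0 _
    have hπ2 : π ^ 2 = π ^ (1 + s) * π ^ (1 - s) := by
      rw [← Real.rpow_add hπ, show 1 + s + (1 - s) = ((2 : ℕ) : ℝ) by push_cast; ring, Real.rpow_natCast]
    rw [hπ2]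
    have key : π ^ (1 + s) * π ^ (1 - s) * (((π ^ (1 + s))⁻¹ - (π ^ (1 + s))⁻¹ / (M ^ (1 + s))⁻¹) / -(1 + s))
        = π ^ (1 - s) * (M ^ (1 + s) - 1) / (1 + s) := by
      field_simp
      ring
    rw [key, show π ^ (1 - s) / (1 + s) * M ^ (1 + s) = π ^ (1 - s) * M ^ (1 + s) / (1 + s) by ring]
    apply div_le_div_of_nonneg_right _ hps.le
    have := Real.rpow_nonneg hπ.le (1 - s)
    nlinarith
  calc (∫ t in (0:ℝ)..π / M, g t) + ∫ t in π / M..π, g t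
      ≤ π ^ (1 - s) / (1 - s) * M ^ (1 + s) + π ^ (1 - s) / (1 + s) * M ^ (1 + s) := by
        linarith [h1, h1v, h2, h2v]
    _ = π ^ (1 - s) * (1 / (1 - s) + 1 / (1 + s)) * M ^ (1 + s) := by ring

/-- **The one-dimensional estimate** on `[-π, π]` (by evenness, twice the half-line estimate). -/
theorem setIntegral_majorant_le {s M : ℝ} (hs0 : 0 < s) (hs : s < 1) (hM : 1 ≤ M) :
    ∫ t in Set.Icc (-π) π, |t| ^ (-s) * (min M (π / |t|)) ^ 2
      ≤ 2 * π ^ (1 - s) * (1 / (1 - s) + 1 / (1 + s)) * M ^ (1 + s) := by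
  have hπ := Real.pi_pos
  have hM0 : 0 < M := by linarith
  set g : ℝ → ℝ := fun t => |t| ^ (-s) * (min M (π / |t|)) ^ 2 with hg
  have hgi : ∀ a b, IntervalIntegrable g volume a b := fun a b => intervalIntegrable_majorant hs hM0.le a b
  rw [integral_Icc_eq_integral_Ioc, ← intervalIntegral.integral_of_le (by linarith),
    ← integral_add_adjacent_intervals (hgi (-π) 0) (hgi 0 π)]
  have heven : ∫ t in -π..(0:ℝ), g t = ∫ t in (0:ℝ)..π, g t := by
    have h1 : ∫ t in (0:ℝ)..π, g t = ∫ t in (0:ℝ)..π, g (-t) := by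
      refine intervalIntegral.integral_congr fun t _ => ?_
      simp only [hg, abs_neg]
    rw [h1, intervalIntegral.integral_comp_neg, neg_zero]
  rw [heven]
  have := integral_majorant_half_le hs0 hs hM
  linarith

/-- The majorant is integrable on `[-π, π]`. -/
theorem integrableOn_majorant {s M : ℝ} (hs : s < 1) (hM : 0 ≤ M) :
    IntegrableOn (fun t : ℝ => |t| ^ (-s) * (min M (π / |t|)) ^ 2) (Set.Icc (-π) π) := by
  have h := intervalIntegrable_majorant hs hM (-π) π
  rw [intervalIntegrable_iff_integrableOn_Icc_of_le (by linarith [Real.pi_pos])] at h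
  exact h

end Integral1D

end Summit.CriticalPhenomena.Ising3DConformalLimit.Theorems.EtaBoundsTransfer

namespace Summit.CriticalPhenomena.Ising3DConformalLimit.Theorems.EtaBoundsTransfer

open Real MeasureTheory Set Finset Literature.Probability.LatticeModels
open scoped BigOperators

section IntegralD

variable {d : ℕ}

/-- **Geometric-mean bound**: `‖k‖^{-α} ≤ ∏_j |k_j|^{-α/d}` when all coordinates are nonzero
(since `∏_j |k_j| ≤ ‖k‖_∞^d`). -/
theorem norm_rpow_neg_le_prod (hd : 1 ≤ d) {α : ℝ} (hα0 : 0 ≤ α) {k : Fin d → ℝ}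
    (hk0 : ∀ j, k j ≠ 0) :
    ‖k‖ ^ (-α) ≤ ∏ j : Fin d, |k j| ^ (-(α / d)) := by
  have hdpos : (0 : ℝ) < d := by exact_mod_cast hd
  have hpk : 0 < ∏ j : Fin d, |k j| := Finset.prod_pos fun j _ => abs_pos.2 (hk0 j)
  have hnk : 0 < ‖k‖ := by
    have : |k ⟨0, hd⟩| ≤ ‖k‖ := by
      have := norm_le_pi_norm k ⟨0, hd⟩; rwa [Real.norm_eq_abs] at this
    exact lt_of_lt_of_le (abs_pos.2 (hk0 _)) this
  have h1 : ∏ j : Fin d, |k j| ≤ ‖k‖ ^ d := by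
    calc ∏ j : Fin d, |k j| ≤ ∏ _j : Fin d, ‖k‖ :=
          Finset.prod_le_prod (fun j _ => abs_nonneg _) fun j _ => by
            have := norm_le_pi_norm k j; rwa [Real.norm_eq_abs] at this
      _ = ‖k‖ ^ d := by rw [Finset.prod_const, Finset.card_univ, Fintype.card_fin]
  have h2 : (∏ j : Fin d, |k j|) ^ (α / d) ≤ ‖k‖ ^ α := by
    calc (∏ j : Fin d, |k j|) ^ (α / d) ≤ (‖k‖ ^ d) ^ (α / d) :=
          Real.rpow_le_rpow hpk.le h1 (div_nonneg hα0 hdpos.le)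
      _ = ‖k‖ ^ α := by
          rw [← Real.rpow_natCast, ← Real.rpow_mul hnk.le]
          congr 1; field_simp
  rw [Real.rpow_neg hnk.le, Real.finsetProd_rpow _ _ (fun j _ => abs_nonneg (k j)),
    Real.rpow_neg hpk.le]
  exact inv_anti₀ (Real.rpow_pos_of_pos hpk _) h2

/-- Almost every point of `ℝ^d` has all coordinates nonzero. -/
theorem ae_forall_coord_ne_zero : ∀ᵐ k ∂(volume : Measure (Fin d → ℝ)), ∀ j, k j ≠ 0 := by
  rw [ae_all_iff]
  intro j
  have h : (volume : Measure (Fin d → ℝ)) {k | k j = 0} = 0 := by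
    rw [MeasureTheory.volume_pi]
    exact Measure.pi_hyperplane _ j 0
  rw [ae_iff]
  simpa using h

/-- **The Brillouin-zone integral bound**: for `0 < α < d` (`d ≥ 1`) and the box weight
`W_m(k) = ∑_{y,y' ∈ Λ_m} cos(k·(y−y'))`, the function `‖k‖^{-α} W_m(k)` is integrable on
`[-π,π]^d` and `∫ ‖k‖^{-α} W_m ≤ C(d,α) (2m+1)^{d+α}` with
`C(d,α) = (2 π^{1-s} (1/(1−s) + 1/(1+s)))^d`, `s = α/d` (product majorant and the
one-dimensional estimate). -/
theorem integral_cube_weight_le (hd : 1 ≤ d) {α : ℝ} (hα0 : 0 < α) (hαd : α < d) (m : ℕ) :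
    IntegrableOn (fun k : Fin d → ℝ => ‖k‖ ^ (-α) *
        ∑ y ∈ box d m, ∑ y' ∈ box d m, Real.cos (phase d k (y - y')))
      (Set.pi Set.univ (fun _ : Fin d => Set.Icc (-π) π)) ∧
    ∫ k in Set.pi Set.univ (fun _ : Fin d => Set.Icc (-π) π),
        ‖k‖ ^ (-α) * ∑ y ∈ box d m, ∑ y' ∈ box d m, Real.cos (phase d k (y - y'))
      ≤ (2 * π ^ (1 - α / d) * (1 / (1 - α / d) + 1 / (1 + α / d))) ^ d
          * (2 * m + 1 : ℝ) ^ ((d : ℝ) + α) := by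
  have hπ := Real.pi_pos
  have hdpos : (0 : ℝ) < d := by exact_mod_cast hd
  set s : ℝ := α / d with hs
  have hs0 : 0 < s := div_pos hα0 hdpos
  have hs1 : s < 1 := (div_lt_one hdpos).2 hαd
  set M : ℝ := 2 * m + 1 with hM
  have hM1 : 1 ≤ M := by rw [hM]; have := Nat.cast_nonneg (α := ℝ) m; linarith
  set K := Set.pi Set.univ (fun _ : Fin d => Set.Icc (-π) π) with hK
  set W : (Fin d → ℝ) → ℝ := fun k => ∑ y ∈ box d m, ∑ y' ∈ box d m, Real.cos (phase d k (y - y'))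
    with hW
  set g : ℝ → ℝ := fun t => |t| ^ (-s) * (min M (π / |t|)) ^ 2 with hg
  set Gm : (Fin d → ℝ) → ℝ := fun k => ∏ j : Fin d, g (k j) with hGm
  -- the restricted measure is a product measure
  have hμ : (volume : Measure (Fin d → ℝ)).restrict K
      = Measure.pi (fun _ : Fin d => (volume : Measure ℝ).restrict (Set.Icc (-π) π)) := by
    rw [MeasureTheory.volume_pi, hK, Measure.restrict_pi_pi]
  -- integrability and integral of the majorant
  have hg_int : Integrable g ((volume : Measure ℝ).restrict (Set.Icc (-π) π)) :=
    integrableOn_majorant hs1 (by linarith)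
  have hGm_int : Integrable Gm ((volume : Measure (Fin d → ℝ)).restrict K) := by
    rw [hμ]
    exact Integrable.fintype_prod (f := fun _ : Fin d => g) (fun _ => hg_int)
  have hGm_val : ∫ k, Gm k ∂((volume : Measure (Fin d → ℝ)).restrict K)
      = (∫ t in Set.Icc (-π) π, g t) ^ d := by
    rw [hμ, hGm]
    rw [integral_fintype_prod_eq_pow (ι := Fin d) g, Fintype.card_fin]
  have hJ0 : 0 ≤ ∫ t in Set.Icc (-π) π, g t :=
    setIntegral_nonneg measurableSet_Icc fun t _ => majorant_nonneg s M t
  have hJ := setIntegral_majorant_le hs0 hs1 hM1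
  -- the a.e. pointwise bound
  have hWnn : ∀ k, 0 ≤ W k := fun k => sum_box_box_cos_phase_sub_nonneg m k
  have hWcont : Continuous W := by
    simp only [hW]
    refine continuous_finsetSum _ fun y _ => continuous_finsetSum _ fun y' _ => ?_
    have := continuous_phase (d := d) (y - y'); fun_prop
  have hmeas : AEStronglyMeasurable (fun k : Fin d → ℝ => ‖k‖ ^ (-α) * W k)
      ((volume : Measure (Fin d → ℝ)).restrict K) := by
    refine (Measurable.mul ?_ hWcont.measurable).aestronglyMeasurable
    exact (continuous_norm.measurable).pow_const _
  have hbound : ∀ᵐ k ∂((volume : Measure (Fin d → ℝ)).restrict K),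
      ‖‖k‖ ^ (-α) * W k‖ ≤ Gm k := by
    rw [ae_restrict_iff' (MeasurableSet.univ_pi fun _ => measurableSet_Icc)]
    filter_upwards [ae_forall_coord_ne_zero (d := d)] with k hk0 hkK
    have hkj : ∀ j, |k j| ≤ π := fun j => abs_le.2 (hkK j (Set.mem_univ j))
    rw [Real.norm_eq_abs, abs_of_nonneg (mul_nonneg (Real.rpow_nonneg (norm_nonneg _) _) (hWnn k))]
    calc ‖k‖ ^ (-α) * W k ≤ (∏ j : Fin d, |k j| ^ (-s)) * ∏ j : Fin d, (min M (π / |k j|)) ^ 2 := by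
          apply mul_le_mul (norm_rpow_neg_le_prod hd hα0.le hk0) _ (hWnn k)
            (Finset.prod_nonneg fun j _ => Real.rpow_nonneg (abs_nonneg _) _)
          have := sum_box_box_cos_phase_sub_le m hkj hk0
          simpa only [hW, hM] using this
      _ = Gm k := by rw [hGm, hg]; simp only; rw [← Finset.prod_mul_distrib]
  have hint : Integrable (fun k : Fin d → ℝ => ‖k‖ ^ (-α) * W k)
      ((volume : Measure (Fin d → ℝ)).restrict K) :=
    Integrable.mono' hGm_int hmeas hbound
  refine ⟨hint, ?_⟩
  have hle : ∫ k in K, ‖k‖ ^ (-α) * W k ≤ ∫ k in K, Gm k := by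
    refine integral_mono_ae hint hGm_int ?_
    filter_upwards [hbound] with k hk
    exact (le_abs_self _).trans (by rwa [Real.norm_eq_abs] at hk)
  calc ∫ k in K, ‖k‖ ^ (-α) * W k ≤ ∫ k in K, Gm k := hle
    _ = (∫ t in Set.Icc (-π) π, g t) ^ d := hGm_val
    _ ≤ (2 * π ^ (1 - s) * (1 / (1 - s) + 1 / (1 + s)) * M ^ (1 + s)) ^ d :=
        pow_le_pow_left₀ hJ0 hJ d
    _ = (2 * π ^ (1 - s) * (1 / (1 - s) + 1 / (1 + s))) ^ d * M ^ ((d : ℝ) + α) := by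
        rw [mul_pow]
        congr 1
        rw [← Real.rpow_natCast, ← Real.rpow_mul (by linarith)]
        congr 1
        rw [hs]; field_simp

end IntegralD

end Summit.CriticalPhenomena.Ising3DConformalLimit.Theorems.EtaBoundsTransfer
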